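import Mathlib
import Summits.SmoothPoincare4.SmoothPoincare4.Theses.CylinderEntropy

/-!
# Sketch — crux-ideate round 1, ideator 3, crux `CylinderEntropy.CylinderRungTwo` (stmt-SmoothPoincare4-7631)

First lemmas of the idea cards `Ideas/ground-state-relaxation.md` (A1, A2) and
`Ideas/separating-sheet-genealogy.md` (B1).  Nothing here is proved; the point is that the
signatures elaborate over Mathlib + the route file.  The three local abbreviations `cylN`,
`cylF`, `cylEnt` are VERBATIM the inline expressions of the route items (arena, slice-normalised
kernel area, cylinder entropy), factored out only for readability.
-/

open scoped BigOperators Manifold ContDiff ENNReal Topology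
open MeasureTheory Set

namespace Summit.SmoothPoincare4.SmoothPoincare4.Cruxes.CylinderRungTwo.Ideator3

noncomputable section

/-- `ℝ⁶`. -/
abbrev E6 := EuclideanSpace ℝ (Fin 6)

/-- The round cylinder `N = S⁴ × ℝ = {z ∈ ℝ⁶ | z₀² + … + z₄² = 1}` (route arena). -/
def cylN : Set E6 := {z : E6 | ∑ i : Fin 5, z (Fin.castSucc i) ^ 2 = 1}

/-- `vol(S⁴) · H_{S⁴}` as the explicit Gegenbauer series of the route items:
`𝔥 τ c = ∑ₖ e^{-k(k+3)τ} (2k+3)/3 · C_k^{(3/2)}(c)` with `C_k^{(3/2)}` written as its finite sum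
(argument fed as `2c` inside the power, exactly as in the items). -/
def 𝔥 (τ c : ℝ) : ℝ :=
  ∑' k : ℕ, Real.exp (-((k : ℝ) * ((k : ℝ) + 3)) * τ) * ((2 * (k : ℝ) + 3) / 3) *
    ∑ l ∈ Finset.range (k / 2 + 1), (-1 : ℝ) ^ l *
      (∏ j ∈ Finset.range (k - l), ((3 : ℝ) / 2 + (j : ℝ))) /
        (((l.factorial : ℕ) : ℝ) * (((k - 2 * l).factorial : ℕ) : ℝ)) * (2 * c) ^ (k - 2 * l)

/-- Slice-normalised kernel area `F̂_{p,τ}(A)` of the route items (an `ℝ≥0∞`). -/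
def cylF (A : Set E6) (p : E6) (τ : ℝ) : ℝ≥0∞ :=
  (μH[4] (Metric.sphere (0 : EuclideanSpace ℝ (Fin 5)) 1))⁻¹ *
    ∫⁻ z in A, ENNReal.ofReal (𝔥 τ (∑ i : Fin 5, z (Fin.castSucc i) * p (Fin.castSucc i)) *
      Real.exp (-((z 5 - p 5) ^ 2) / (4 * τ))) ∂μH[4]

/-- Cylinder entropy `λ_cyl(A) = sup_{p ∈ N, τ > 0} F̂_{p,τ}(A)` of the route items. -/
def cylEnt (A : Set E6) : ℝ≥0∞ :=
  ⨆ (p : E6) (_ : p ∈ cylN) (τ : ℝ) (_ : 0 < τ), cylF A p τ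

/-- "Separates the two ends of `N`" exactly as in the route items (`JoinedIn` form). -/
def SeparatesEnds (S : Set E6) : Prop :=
  ∃ R : ℝ, ∀ a b : E6, a ∈ cylN → b ∈ cylN → a 5 ≤ -R → R ≤ b 5 → ¬ JoinedIn (cylN \ S) a b

/-! ## Card A — ground-state relaxation -/

/-- **A1 · EntropyDominatesAreaRatio** (first lemma of card A; the `k = 1` forcing step of the
single-slice lemma and the large-scale end of `λ_cyl(M_t) → 1`): for every compact `A ⊆ N`,
`μH⁴(A) / μH⁴(S⁴) ≤ λ_cyl(A)` — as `τ → ∞` the kernel `𝔥(τ,·) → 1` (only the `k = 0` mode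
survives) and the Gaussian factor `→ 1` on the bounded `A`, so Fatou gives the bound.  Provable now
(difficulty M: uniform convergence of the Gegenbauer tail for `τ ≥ 1`, Fatou in `ℝ≥0∞`). -/
def EntropyDominatesAreaRatio : Prop :=
  ∀ A : Set E6, A ⊆ cylN → IsCompact A →
    (μH[4] (Metric.sphere (0 : EuclideanSpace ℝ (Fin 5)) 1))⁻¹ * μH[4] A ≤ cylEnt A

/-- **A2 · StrictHarnackSphereKernel** (card A, the "no cylinder-shrinkers" input): Hamilton's
matrix Harnack form of the zonal heat kernel of `S⁴`, `Hess log 𝔥 + g/(2τ)`, is STRICTLY positive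
definite: in the zonal variable `c = cos θ` its two eigenvalues are the radial one
`(1-c²)(log 𝔥)'' - c (log 𝔥)' + 1/(2τ)` and the tangential one `-c (log 𝔥)' + 1/(2τ)`
(`'` = `d/dc`).  Hamilton 1993 gives `≥ 0` (sec ≥ 0, ∇Ric = 0); strictness is what forces
`ν = ±∂ₛ` in the equality case of his MCF monotonicity, i.e. only slices saturate the monotonicity
(fixed-scale `F̂_{p,τ}`-critical hypersurfaces exist, but no flow keeps `F̂_{p,t₀-t}` constant). -/
def StrictHarnackSphereKernel : Prop :=
  ∀ τ : ℝ, 0 < τ → ∀ c : ℝ, c ∈ Set.Ioo (-1 : ℝ) 1 →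
    0 < (1 - c ^ 2) * deriv (deriv (fun x => Real.log (𝔥 τ x))) c
          - c * deriv (fun x => Real.log (𝔥 τ x)) c + 1 / (2 * τ) ∧
    0 < - c * deriv (fun x => Real.log (𝔥 τ x)) c + 1 / (2 * τ)

/-- **A2' · CoerciveHarnackSphereKernel** (card A, quantitative form suggested by the numerics in
`harnack_check.py` / `harnack_check.out` of this folder: on the resolvable grid both eigenvalues are
`≥ min(0.41, 1/(2τ) - O(e^{-4τ}))`, the small-`τ` floor `1/2 = (n-1)/6` coming from the Van Vleck
factor `(θ/sin θ)^{3/2}`): for `0 < τ ≤ 1` both Harnack eigenvalues are `≥ 2/5`.  Consequence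
(coercive Hamilton monotonicity): `d/dt F̂_{p,t₀-t}(M_t) ≤ -(2/5) ∫ (1 - ⟨ν,∂ₛ⟩²) k̂ dA` at all
scales `t₀ - t ≤ 1` — entropy dissipation dominates Gaussian-weighted TILT. -/
def CoerciveHarnackSphereKernel : Prop :=
  ∀ τ : ℝ, 0 < τ → τ ≤ 1 → ∀ c : ℝ, c ∈ Set.Ioo (-1 : ℝ) 1 →
    (2 : ℝ) / 5 ≤ (1 - c ^ 2) * deriv (deriv (fun x => Real.log (𝔥 τ x))) c
          - c * deriv (fun x => Real.log (𝔥 τ x)) c + 1 / (2 * τ) ∧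
    (2 : ℝ) / 5 ≤ - c * deriv (fun x => Real.log (𝔥 τ x)) c + 1 / (2 * τ)

/-! ## Card B — separating-sheet genealogy -/

/-- **B1 · UniqueSeparatingSheet** (first lemma of card B): below cylinder entropy `2`, at most ONE
connected component of a closed embedded hypersurface of `N` separates the ends.  Proof sketch:
two disjoint separating clopen pieces each carry area `≥ vol S⁴` (route support `AreaFloor`
applied to the open submanifolds), so `μH⁴(range ι) ≥ 2 vol S⁴`, and `A1` gives `λ_cyl ≥ 2`. -/
def UniqueSeparatingSheet : Prop :=
  ∀ (M : Type) [TopologicalSpace M] [T2Space M] [SecondCountableTopology M] [CompactSpace M]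
    [ChartedSpace (EuclideanSpace ℝ (Fin 4)) M] [IsManifold (𝓡 4) ∞ M]
    (ι : M → E6), Manifold.IsSmoothEmbedding (𝓡 4) (𝓡 6) ∞ ι → (∀ x, ι x ∈ cylN) →
    cylEnt (Set.range ι) < 2 →
    ∀ A B : Set M, IsClopen A → IsClopen B → Disjoint A B →
      SeparatesEnds (ι '' A) → SeparatesEnds (ι '' B) → False

/-! ## Sanity: the abbreviations are the route's inline expressions -/

/-- `A1` specialised to a cross-section image is exactly the inequality the route records in
NUMBERS ("F̂_{p,τ}(M) → area(M)/vol(S⁴) as τ → ∞, so λ_cyl ≥ area/vol"); with the filed support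
item `AreaFloor` it yields `1 ≤ λ_cyl` for every cross-section. -/
theorem one_le_cylEnt_of_areaFloor
    (hA1 : EntropyDominatesAreaRatio)
    (M : Type) [TopologicalSpace M] [T2Space M] [SecondCountableTopology M] [CompactSpace M]
    [ChartedSpace (EuclideanSpace ℝ (Fin 4)) M] [IsManifold (𝓡 4) ∞ M]
    (ι : M → E6) (hι : Manifold.IsSmoothEmbedding (𝓡 4) (𝓡 6) ∞ ι) (hN : ∀ x, ι x ∈ cylN)
    (hfloor : μH[4] (Metric.sphere (0 : EuclideanSpace ℝ (Fin 5)) 1) ≤ μH[4] (Set.range ι))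
    (hpos : 0 < μH[4] (Metric.sphere (0 : EuclideanSpace ℝ (Fin 5)) 1))
    (hfin : μH[4] (Metric.sphere (0 : EuclideanSpace ℝ (Fin 5)) 1) ≠ ⊤) :
    1 ≤ cylEnt (Set.range ι) := by
  have hsub : Set.range ι ⊆ cylN := by
    rintro _ ⟨x, rfl⟩; exact hN x
  have hcpt : IsCompact (Set.range ι) := isCompact_range hι.isEmbedding.continuous
  have h := hA1 (Set.range ι) hsub hcpt
  calc (1 : ℝ≥0∞)
      = (μH[4] (Metric.sphere (0 : EuclideanSpace ℝ (Fin 5)) 1))⁻¹ *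
          μH[4] (Metric.sphere (0 : EuclideanSpace ℝ (Fin 5)) 1) := by
        rw [ENNReal.inv_mul_cancel hpos.ne' hfin]
    _ ≤ (μH[4] (Metric.sphere (0 : EuclideanSpace ℝ (Fin 5)) 1))⁻¹ * μH[4] (Set.range ι) := by
        gcongr
    _ ≤ cylEnt (Set.range ι) := h

end

end Summit.SmoothPoincare4.SmoothPoincare4.Cruxes.CylinderRungTwo.Ideator3
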